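import Mathlib
import Summits.ResolutionOfSingularities.ResolutionOfSingularities.Theorems.RadicialJungCleanModelsCleanProp44VertexInsertion
import HarnessLib

/-!
# Route `RadicialJung`, crux `CleanModels` (stmt-ResolutionOfSingularities-15917), line `Sketch` rev 35, stub 6 `stub_cleanProp44` (X44c):
# THE VERTEX OBSTRUCTION OF A NEAR LINE IS RESOLVED BY ONE INSERTION, UP TO A BIRTH (two successive point blowing ups, scheme level)

Seat decomp-res-hand-2 g19 (structural hand).  The consumer's endpoint of brick (vi) (`Cruxes/CleanModels/Lines/Sketch-memo-hand2-g18-stubs-5-7.md`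
§2 (d)): chain ✓ `cleanPermissibleAt_nearLine_or_vertex_or_cross` (hand-2 g18: on a near line `N = (e', y')` of the blowing up `τ : X' → X` of a
clean threefold point `x`, the obstructions are VERTICES and CROSS points) with ✓ `cleanPermissibleAt_strictTransform_of_vertex_or_birth` (this hand:
insertion at a corner point).  Setting: `τ : X' → X` a blowing up with `J_x = 𝔪_x` at `x = τ x'`, the line of `G` presented at `x` by `u · ∏_k c_k^{a_k}`
in a regular system of parameters `c = (c₀, c₁, c₂)` (ARBITRARY exponents), the near line `N = (e', y')` of a regular parameter `t_{j₀}` through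
`x' = σ x''` (`(e') = 𝔪_x 𝒪_{X',x'}`, `τ^♯ t_{j₀} = e' · y'`, `(e', y', z') = 𝔪_{x'}`), and a VERTEX OBSTRUCTION at `x'`: two clean sides
`τ^♯ c_{k₁} = e' · s₁`, `τ^♯ c_{k₂} = e' · s₂` through `x'` (`s₁, s₂ ∈ 𝔪_{x'}`), neither containing `N`.  INSERT: `σ : X'' → X'` a blowing up with
`J'_{x'} = 𝔪_{x'}`, and `x'' ∈ σ⁻¹(x')` on the strict transforms of the old exceptional divisor `V(e')` and of `V(y')`: `σ^♯ e' = E · ε`, `σ^♯ y' = E · ζ`,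
`ε, ζ ∈ 𝔪_{x''}`, `(E) = 𝔪_{x'} 𝒪_{X'',x''}`.

* `cleanPermissibleAt_nearLine_insertion_of_vertex_or_birth` — then `(e', s₁, s₂) = 𝔪_{x'}` and `N` is TRANSVERSAL to both sides (no tangency on near
  lines, ✓ `side_trichotomy_nearLine_of_isBlowup`); at `x''`: `(E, ε, ζ) = 𝔪_{x''}` (the strict transform `N'' = (ε, ζ)` of the near line is a regular
  germ transversal to `E_{x'}`), the two sides have LEFT (`(σ^♯ s_j) = 𝔪_{x'} 𝒪_{X'',x''}`), the transform is `U · ε^{Σ a} · E^{a_{k₁} + a_{k₂} + Σ a}`, and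
  the line is CLEAN-PERMISSIBLE at `x''` for `N''` unless `p ∣ Σ_k a_k`, `p ∣ a_{k₁} + a_{k₂} + Σ_k a_k` and `U` fails the non-birth test.
* `cleanPermissibleAt_nearLine_insertion_of_vertex` — `p ∤ Σ a` or `p ∤ a_{k₁} + a_{k₂} + Σ a` ⟹ clean-permissible after one insertion.

Honest framing: OURS; what is NOT here is the case `p ∣ Σ a`, `p ∣ a_{k₁} + a_{k₂}` (births after insertion; the `δ*`-descent of memo 4e §2.5) and
the global bookkeeping of the new near lines of `E_{x'}` (memo g18 §2 (d) (iii)).  Nothing here proves X44c, any case of `CleanModels`, or resolution of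
singularities in characteristic `p`.  Setting only: [cite: CossartPiltant2008, Lemma 4.3 (5); Prop. 4.4 (proof, p. 11)] [cite: Piltant2013, §2 Axiom 4]
[cite: GortzWedhorn2020, Prop. 13.91].
-/

noncomputable section

set_option linter.dupNamespace false -- mandated namespace of this single-conjunct summit

open IsLocalRing CategoryTheory AlgebraicGeometry
open Literature.AlgebraicGeometry.Resolution Literature.AlgebraicGeometry.Motives

namespace Summit.ResolutionOfSingularities.ResolutionOfSingularities.Theorems.RadicialJung.CleanModels

universe u

section Scheme

variable {p : ℕ} {X X' X'' : Scheme.{u}} [IsIntegral X] [IsIntegral X'] [IsIntegral X''] {τ : X' ⟶ X} [IsDominant τ]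
  {σ : X'' ⟶ X'} [IsDominant σ] {J : X.IdealSheafData} {J' : X'.IdealSheafData}

set_option maxHeartbeats 1600000 in
-- two blowing ups, one normal form, one insertion theorem
/-- **THE VERTEX OBSTRUCTION OF A NEAR LINE IS RESOLVED BY ONE INSERTION, UP TO A BIRTH.**  See the module docstring.
[cite: CossartPiltant2008, Lemma 4.3 (5); Prop. 4.4 (proof, p. 11)] [cite: Piltant2013, §2 Axiom 4] -/
theorem cleanPermissibleAt_nearLine_insertion_of_vertex_or_birth [Fact p.Prime] [CharP X''.functionField p] (hτ : IsBlowup τ J)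
    (hσ : IsBlowup σ J') (x'' : X'') (hR : IsRegularLocalRing (X.presheaf.stalk (τ (σ x''))))
    (c : Fin 3 → X.presheaf.stalk (τ (σ x''))) (hc : Ideal.span (Set.range c) = maximalIdeal (X.presheaf.stalk (τ (σ x''))))
    (hdim : ringKrullDim (X.presheaf.stalk (τ (σ x''))) = (3 : ℕ))
    (hJ : stalkIdeal J (τ (σ x'')) = maximalIdeal (X.presheaf.stalk (τ (σ x''))))
    {G : X.functionField} {cc : Fin p → X.functionField} (hcc : ∃ j : Fin p, (j : ℕ) ≠ 0 ∧ cc j ≠ 0)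
    {u : X.presheaf.stalk (τ (σ x''))} (hu : IsUnit u) (a : Fin 3 → ℕ)
    (hrep : (∑ j : Fin p, cc j ^ p * G ^ (j : ℕ)) = RatFn.toFunctionField (τ (σ x'')) (u * ∏ k, c k ^ a k))
    (hdim' : ringKrullDim (X'.presheaf.stalk (σ x'')) = 3) (hJ' : stalkIdeal J' (σ x'') = maximalIdeal (X'.presheaf.stalk (σ x'')))
    {d : ℕ} (t : Fin d → X.presheaf.stalk (τ (σ x''))) (hspan : Ideal.span (Set.range t) = maximalIdeal (X.presheaf.stalk (τ (σ x''))))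
    (hdimd : ringKrullDim (X.presheaf.stalk (τ (σ x''))) = (d : WithBot ℕ∞)) (j₀ : Fin d) {e' y' z' : X'.presheaf.stalk (σ x'')}
    (he' : Ideal.span {e'} = (maximalIdeal (X.presheaf.stalk (τ (σ x'')))).map (τ.stalkMap (σ x'')).hom)
    (hy' : (τ.stalkMap (σ x'')).hom (t j₀) = e' * y') (hy'm : y' ∈ maximalIdeal (X'.presheaf.stalk (σ x'')))
    (hzz : Ideal.span ({e', y', z'} : Set (X'.presheaf.stalk (σ x''))) = maximalIdeal (X'.presheaf.stalk (σ x'')))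
    {k₁ k₂ : Fin 3} (hk : k₁ ≠ k₂) {s₁ s₂ : X'.presheaf.stalk (σ x'')}
    (hs₁ : (τ.stalkMap (σ x'')).hom (c k₁) = e' * s₁) (hs₂ : (τ.stalkMap (σ x'')).hom (c k₂) = e' * s₂)
    (hs₁m : s₁ ∈ maximalIdeal (X'.presheaf.stalk (σ x''))) (hs₂m : s₂ ∈ maximalIdeal (X'.presheaf.stalk (σ x'')))
    (hs₁N : s₁ ∉ Ideal.span ({e', y'} : Set (X'.presheaf.stalk (σ x''))))
    (hs₂N : s₂ ∉ Ideal.span ({e', y'} : Set (X'.presheaf.stalk (σ x''))))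
    (hdim'' : ringKrullDim (X''.presheaf.stalk x'') = 3) {E ε ζ : X''.presheaf.stalk x''}
    (hE : Ideal.span {E} = (maximalIdeal (X'.presheaf.stalk (σ x''))).map (σ.stalkMap x'').hom)
    (hε : (σ.stalkMap x'').hom e' = E * ε) (hεm : ε ∈ maximalIdeal (X''.presheaf.stalk x''))
    (hζ : (σ.stalkMap x'').hom y' = E * ζ) (hζm : ζ ∈ maximalIdeal (X''.presheaf.stalk x'')) :
    Ideal.span ({e', s₁, s₂} : Set (X'.presheaf.stalk (σ x''))) = maximalIdeal (X'.presheaf.stalk (σ x'')) ∧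
    Ideal.span ({e', y', s₁} : Set (X'.presheaf.stalk (σ x''))) = maximalIdeal (X'.presheaf.stalk (σ x'')) ∧
    Ideal.span ({e', y', s₂} : Set (X'.presheaf.stalk (σ x''))) = maximalIdeal (X'.presheaf.stalk (σ x'')) ∧
    Ideal.span ({E, ε, ζ} : Set (X''.presheaf.stalk x'')) = maximalIdeal (X''.presheaf.stalk x'') ∧
    Ideal.span {(σ.stalkMap x'').hom s₁} = (maximalIdeal (X'.presheaf.stalk (σ x''))).map (σ.stalkMap x'').hom ∧
    Ideal.span {(σ.stalkMap x'').hom s₂} = (maximalIdeal (X'.presheaf.stalk (σ x''))).map (σ.stalkMap x'').hom ∧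
    ∃ U : X''.presheaf.stalk x'', IsUnit U ∧
      (∑ j : Fin p, RatFn.functionFieldMap σ (RatFn.functionFieldMap τ (cc j)) ^ p *
          RatFn.functionFieldMap σ (RatFn.functionFieldMap τ G) ^ (j : ℕ)) =
        RatFn.toFunctionField x'' (U * ε ^ (∑ k, a k) * E ^ (a k₁ + a k₂ + ∑ k, a k)) ∧
      (CleanPermissibleAt p (RatFn.toFunctionField x'') (RatFn.functionFieldMap σ (RatFn.functionFieldMap τ G))
          (Ideal.span ({ε, ζ} : Set (X''.presheaf.stalk x''))) ∨
        (p ∣ ∑ k, a k ∧ p ∣ a k₁ + a k₂ + ∑ k, a k ∧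
          ¬ ((∀ c' : X''.presheaf.stalk x'', U - c' ^ p ∉ maximalIdeal (X''.presheaf.stalk x'')) ∨
            (∃ c' : X''.presheaf.stalk x'', U - c' ^ p ∈ maximalIdeal (X''.presheaf.stalk x'') ∧
              U - c' ^ p ∉ Ideal.span ({ε, ζ} : Set (X''.presheaf.stalk x'')) ⊔ maximalIdeal (X''.presheaf.stalk x'') ^ 2) ∨
            (∃ c' : X''.presheaf.stalk x'', U - c' ^ p ∈ Ideal.span ({ε, ζ} : Set (X''.presheaf.stalk x'')) ∧
              U - c' ^ p ∉ maximalIdeal (X''.presheaf.stalk x'') ^ 2)))) := by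
  classical
  -- bookkeeping for the point centre at `x`
  have hdim0 : ringKrullDim (X.presheaf.stalk (τ (σ x''))) = ((3 + 0 : ℕ) : WithBot ℕ∞) := by rw [Nat.add_zero]; exact hdim
  have hz0 : Ideal.span (Set.range (Fin.append c Fin.elim0)) = maximalIdeal (X.presheaf.stalk (τ (σ x''))) := by
    rw [span_range_append_elim0_eq, hc]
  have hcJ : Ideal.span (Set.range c) = stalkIdeal J (τ (σ x'')) := hc.trans hJ.symm
  have hcm : ∀ k, c k ∈ maximalIdeal (X.presheaf.stalk (τ (σ x''))) := fun k => hc ▸ Ideal.subset_span ⟨k, rfl⟩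
  -- (I) the normal form of the representative at `x' = σ x''`
  obtain ⟨i, uf, m, jJ, hrel, -, hjJ, hch, hcomplete, hrsop, U, hU, -, heq⟩ :=
    exists_transform_normalForm_of_isBlowup hτ (σ x'') hR c Fin.elim0 hz0 hdim0 hcJ a Fin.elim0 hu
  simp only [Finset.univ_eq_empty, Finset.prod_empty, mul_one] at heq
  have hR' : IsRegularLocalRing (X'.presheaf.stalk (σ x'')) := hrsop.isRegularLocalRing
  haveI := isDomain_of_isRegularLocalRing (X'.presheaf.stalk (σ x''))
  have hei : (τ.stalkMap (σ x'')).hom (c i) ≠ 0 := by simpa using hrsop.ne_zero 0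
  have hEi : Ideal.span {(τ.stalkMap (σ x'')).hom (c i)} = (maximalIdeal (X.presheaf.stalk (τ (σ x'')))).map (τ.stalkMap (σ x'')).hom := by
    rw [← hc]; exact span_singleton_eq_map_span_of_rel _ c i uf hrel
  obtain ⟨v, hv⟩ : Associated e' ((τ.stalkMap (σ x'')).hom (c i)) := Ideal.span_singleton_eq_span_singleton.mp (he'.trans hEi.symm)
  have he'0 : e' ≠ 0 := left_ne_zero_of_mul (hv.symm ▸ hei)
  -- both sides are charged: `k_j ≠ i`, `uf_{k_j} = v⁻¹ s_j ∈ 𝔪`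
  have key : ∀ {k : Fin 3} {s : X'.presheaf.stalk (σ x'')}, (τ.stalkMap (σ x'')).hom (c k) = e' * s →
      s ∈ maximalIdeal (X'.presheaf.stalk (σ x'')) → uf k = ↑v⁻¹ * s ∧ uf k ∈ maximalIdeal (X'.presheaf.stalk (σ x'')) ∧ k ≠ i := by
    intro k s hs hsm
    have hvuf : ↑v * uf k = s := by
      apply mul_left_cancel₀ he'0
      rw [← mul_assoc, hv, ← hrel k, hs]
    have huf : uf k = ↑v⁻¹ * s := by rw [← hvuf, ← mul_assoc, Units.inv_mul, one_mul]
    have hufm : uf k ∈ maximalIdeal (X'.presheaf.stalk (σ x'')) := by rw [huf]; exact Ideal.mul_mem_left _ _ hsm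
    refine ⟨huf, hufm, ?_⟩
    rintro rfl
    have h1 : (τ.stalkMap (σ x'')).hom (c k) * uf k = (τ.stalkMap (σ x'')).hom (c k) * 1 := by rw [mul_one, ← hrel]
    have h2 : uf k = 1 := mul_left_cancel₀ hei h1
    exact mem_nonunits_iff.mp ((mem_maximalIdeal _).mp hufm) (h2 ▸ isUnit_one)
  obtain ⟨huf₁, huf₁m, hk₁i⟩ := key hs₁ hs₁m
  obtain ⟨huf₂, huf₂m, hk₂i⟩ := key hs₂ hs₂m
  obtain ⟨q₁, hq₁⟩ := hcomplete k₁ hk₁i huf₁m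
  obtain ⟨q₂, hq₂⟩ := hcomplete k₂ hk₂i huf₂m
  have hq : q₁ ≠ q₂ := fun h => hk (by rw [← hq₁, ← hq₂, h])
  -- every charged index is `k₁` or `k₂`
  obtain ⟨i', hi'₁, hi'₂, huniv⟩ := exists_third_fin_three k₁ k₂ hk
  have hii' : i = i' := by
    rcases huniv i with h | h | h
    · exact h
    · exact absurd h.symm hk₁i
    · exact absurd h.symm hk₂i
  have hq12 : ∀ q, q = q₁ ∨ q = q₂ := by
    intro q
    rcases huniv (jJ q).1 with h | h | h
    · exact absurd (h.trans hii'.symm) (jJ q).2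
    · exact Or.inl (hjJ (Subtype.ext (h.trans hq₁.symm)))
    · exact Or.inr (hjJ (Subtype.ext (h.trans hq₂.symm)))
  have hprod1 : ∏ q, uf (jJ q).1 ^ a (jJ q).1 = uf k₁ ^ a k₁ * uf k₂ ^ a k₂ := by
    rw [Finset.prod_eq_mul q₁ q₂ hq (fun q _ h => by rcases hq12 q with h' | h' <;> [exact absurd h' h.1; exact absurd h' h.2])
      (fun h => absurd (Finset.mem_univ _) h) (fun h => absurd (Finset.mem_univ _) h), hq₁, hq₂]
  -- the representative at `x'` in the regular system `(s₁, s₂, e')`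
  set V' : X'.presheaf.stalk (σ x'') := U * ↑v ^ (∑ k, a k) * ↑v⁻¹ ^ a k₁ * ↑v⁻¹ ^ a k₂ with hV'
  have hV'u : IsUnit V' := ((hU.mul ((Units.isUnit v).pow _)).mul ((Units.isUnit v⁻¹).pow _)).mul ((Units.isUnit v⁻¹).pow _)
  have hprod3 : ∏ k, (![s₁, s₂, e'] : Fin 3 → X'.presheaf.stalk (σ x'')) k ^ (![a k₁, a k₂, ∑ k, a k] : Fin 3 → ℕ) k =
      s₁ ^ a k₁ * s₂ ^ a k₂ * e' ^ (∑ k, a k) := by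
    rw [Fin.prod_univ_three]; rfl
  have heq' : (τ.stalkMap (σ x'')).hom (u * ∏ k, c k ^ a k) =
      V' * ∏ k, (![s₁, s₂, e'] : Fin 3 → X'.presheaf.stalk (σ x'')) k ^ (![a k₁, a k₂, ∑ k, a k] : Fin 3 → ℕ) k := by
    rw [hprod3, heq, hprod1, huf₁, huf₂, ← hv, mul_pow, mul_pow, mul_pow]; ring
  obtain ⟨hcc', hrep'⟩ := rep_functionFieldMap (σ x'') hcc hrep
  rw [heq'] at hrep'
  -- `(e', s₁, s₂) = 𝔪_{x'}`
  have htriple : IsRsopPart ![e', s₁, s₂] := by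
    have hinj : Function.Injective (![0, Fin.succ (Fin.castAdd 0 q₁), Fin.succ (Fin.castAdd 0 q₂)] : Fin 3 → Fin (m + 0 + 1)) := by
      have hne12 : Fin.succ (Fin.castAdd 0 q₁) ≠ Fin.succ (Fin.castAdd 0 q₂) := fun h =>
        hq (Fin.castAdd_injective _ _ (Fin.succ_injective _ h))
      intro t₁ t₂ h
      fin_cases t₁ <;> fin_cases t₂
      all_goals (first | rfl | (exfalso; simp only [Fin.zero_eta, Fin.mk_one, Fin.reduceFinMk, Matrix.cons_val_zero, Matrix.cons_val_one,
        Matrix.cons_val_two, Matrix.tail_cons, Matrix.head_cons] at h; first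
          | exact Fin.succ_ne_zero _ h | exact Fin.succ_ne_zero _ h.symm | exact hne12 h | exact hne12 h.symm))
    have h1 := hrsop.comp _ hinj
    have h2 : (Fin.cons ((τ.stalkMap (σ x'')).hom (c i))
        (Fin.append (fun q => uf (jJ q).1) fun m' => (τ.stalkMap (σ x'')).hom (Fin.elim0 m' : X.presheaf.stalk (τ (σ x'')))) :
        Fin (m + 0 + 1) → X'.presheaf.stalk (σ x'')) ∘
        (![0, Fin.succ (Fin.castAdd 0 q₁), Fin.succ (Fin.castAdd 0 q₂)] : Fin 3 → Fin (m + 0 + 1)) =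
        ![(τ.stalkMap (σ x'')).hom (c i), uf k₁, uf k₂] := by
      funext t'
      fin_cases t'
      · rfl
      · simp only [Function.comp_apply, Fin.mk_one, Matrix.cons_val_one, Matrix.cons_val_zero, Fin.cons_succ, Fin.append_left, hq₁]
      · simp only [Function.comp_apply, Fin.reduceFinMk, Matrix.cons_val, Fin.cons_succ, Fin.append_left, hq₂]
    rw [h2] at h1
    refine h1.of_associated fun t' => ?_
    fin_cases t'
    · change Associated ((τ.stalkMap (σ x'')).hom (c i)) e'
      exact ⟨v⁻¹, by rw [← hv, mul_assoc, Units.mul_inv, mul_one]⟩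
    · change Associated (uf k₁) s₁
      exact ⟨v, by rw [huf₁, mul_comm, ← mul_assoc, Units.mul_inv, one_mul]⟩
    · change Associated (uf k₂) s₂
      exact ⟨v, by rw [huf₂, mul_comm, ← mul_assoc, Units.mul_inv, one_mul]⟩
  have hss : Ideal.span ({e', s₁, s₂} : Set (X'.presheaf.stalk (σ x''))) = maximalIdeal (X'.presheaf.stalk (σ x'')) :=
    span_triple_eq_maximalIdeal_of_isRsopPart htriple hdim'
  have hc' : Ideal.span (Set.range (![s₁, s₂, e'] : Fin 3 → X'.presheaf.stalk (σ x''))) = maximalIdeal (X'.presheaf.stalk (σ x'')) := by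
    rw [← hss]
    congr 1
    ext r
    simp only [Set.mem_range, Set.mem_insert_iff, Set.mem_singleton_iff]
    constructor
    · rintro ⟨j, rfl⟩
      fin_cases j <;> simp
    · rintro (rfl | rfl | rfl)
      exacts [⟨2, rfl⟩, ⟨0, rfl⟩, ⟨1, rfl⟩]
  -- NO TANGENCY on the near line: both sides are transversal to `N`
  have htrans : ∀ {k : Fin 3} {s : X'.presheaf.stalk (σ x'')}, (τ.stalkMap (σ x'')).hom (c k) = e' * s →
      s ∈ maximalIdeal (X'.presheaf.stalk (σ x'')) → s ∉ Ideal.span ({e', y'} : Set (X'.presheaf.stalk (σ x''))) →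
      Ideal.span ({e', y', s} : Set (X'.presheaf.stalk (σ x''))) = maximalIdeal (X'.presheaf.stalk (σ x'')) := by
    intro k s hs hsm hsN
    obtain ⟨s', hs', htri⟩ := side_trichotomy_nearLine_of_isBlowup hτ (σ x'') hR t hspan hdimd hJ j₀ he' hy' hy'm hzz (hcm k)
    have hss' : s' = s := mul_left_cancel₀ he'0 (hs'.symm.trans hs)
    subst hss'
    rcases htri with h | h | h
    · exact absurd h (mem_nonunits_iff.mp ((mem_maximalIdeal _).mp hsm))
    · exact h
    · exact absurd h hsN
  have ht₁ := htrans hs₁ hs₁m hs₁N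
  have ht₂ := htrans hs₂ hs₂m hs₂N
  have hz' : ∀ k : Fin 3, k ≠ 2 → Ideal.span ({y', (![s₁, s₂, e'] : Fin 3 → X'.presheaf.stalk (σ x'')) k,
      (![s₁, s₂, e'] : Fin 3 → X'.presheaf.stalk (σ x'')) 2} : Set (X'.presheaf.stalk (σ x''))) = maximalIdeal (X'.presheaf.stalk (σ x'')) := by
    have hswap : ∀ a₁ a₂ a₃ : X'.presheaf.stalk (σ x''), ({a₂, a₃, a₁} : Set (X'.presheaf.stalk (σ x''))) = {a₁, a₂, a₃} := by
      intro a₁ a₂ a₃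
      ext r
      simp only [Set.mem_insert_iff, Set.mem_singleton_iff]
      tauto
    intro k hk
    fin_cases k
    · change Ideal.span ({y', s₁, e'} : Set (X'.presheaf.stalk (σ x''))) = _
      rw [hswap]; exact ht₁
    · change Ideal.span ({y', s₂, e'} : Set (X'.presheaf.stalk (σ x''))) = _
      rw [hswap]; exact ht₂
    · exact absurd rfl hk
  -- (II) the insertion theorem at `x''`
  have hdim'3 : ringKrullDim (X'.presheaf.stalk (σ x'')) = (3 : ℕ) := by rw [hdim']; norm_cast
  obtain ⟨hEεζ, hpass, U'', hU'', hrep'', hfinal⟩ :=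
    cleanPermissibleAt_strictTransform_of_vertex_or_birth hσ x'' hR' ![s₁, s₂, e'] hc' hdim'3 hJ' hcc' hV'u ![a k₁, a k₂, ∑ k, a k] hrep' 2
      hz' hdim'' hE hε hεm hζ hζm
  have hsum : ∑ k, (![a k₁, a k₂, ∑ k, a k] : Fin 3 → ℕ) k = a k₁ + a k₂ + ∑ k, a k := by
    rw [Fin.sum_univ_three]; rfl
  refine ⟨hss, ht₁, ht₂, hEεζ, hpass 0 (by decide), hpass 1 (by decide), U'', hU'', ?_, ?_⟩
  · rw [hrep'', hsum]; rfl
  · rcases hfinal with h | ⟨h₁, h₂, h₃⟩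
    · exact Or.inl h
    · exact Or.inr ⟨h₁, hsum ▸ h₂, h₃⟩

/-- **One insertion resolves the vertex obstruction of a near line when an exponent in sight is prime to `p`**: in the same setting, if `p ∤ Σ a_k` or
`p ∤ a_{k₁} + a_{k₂} + Σ a_k`, the strict transform `N'' = (ε, ζ)` of the near line is clean-permissible at `x''`.
[cite: CossartPiltant2008, Lemma 4.3 (5)] [cite: Piltant2013, §2 Axiom 4] -/
theorem cleanPermissibleAt_nearLine_insertion_of_vertex [Fact p.Prime] [CharP X''.functionField p] (hτ : IsBlowup τ J)
    (hσ : IsBlowup σ J') (x'' : X'') (hR : IsRegularLocalRing (X.presheaf.stalk (τ (σ x''))))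
    (c : Fin 3 → X.presheaf.stalk (τ (σ x''))) (hc : Ideal.span (Set.range c) = maximalIdeal (X.presheaf.stalk (τ (σ x''))))
    (hdim : ringKrullDim (X.presheaf.stalk (τ (σ x''))) = (3 : ℕ))
    (hJ : stalkIdeal J (τ (σ x'')) = maximalIdeal (X.presheaf.stalk (τ (σ x''))))
    {G : X.functionField} {cc : Fin p → X.functionField} (hcc : ∃ j : Fin p, (j : ℕ) ≠ 0 ∧ cc j ≠ 0)
    {u : X.presheaf.stalk (τ (σ x''))} (hu : IsUnit u) (a : Fin 3 → ℕ)
    (hrep : (∑ j : Fin p, cc j ^ p * G ^ (j : ℕ)) = RatFn.toFunctionField (τ (σ x'')) (u * ∏ k, c k ^ a k))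
    (hdim' : ringKrullDim (X'.presheaf.stalk (σ x'')) = 3) (hJ' : stalkIdeal J' (σ x'') = maximalIdeal (X'.presheaf.stalk (σ x'')))
    {d : ℕ} (t : Fin d → X.presheaf.stalk (τ (σ x''))) (hspan : Ideal.span (Set.range t) = maximalIdeal (X.presheaf.stalk (τ (σ x''))))
    (hdimd : ringKrullDim (X.presheaf.stalk (τ (σ x''))) = (d : WithBot ℕ∞)) (j₀ : Fin d) {e' y' z' : X'.presheaf.stalk (σ x'')}
    (he' : Ideal.span {e'} = (maximalIdeal (X.presheaf.stalk (τ (σ x'')))).map (τ.stalkMap (σ x'')).hom)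
    (hy' : (τ.stalkMap (σ x'')).hom (t j₀) = e' * y') (hy'm : y' ∈ maximalIdeal (X'.presheaf.stalk (σ x'')))
    (hzz : Ideal.span ({e', y', z'} : Set (X'.presheaf.stalk (σ x''))) = maximalIdeal (X'.presheaf.stalk (σ x'')))
    {k₁ k₂ : Fin 3} (hk : k₁ ≠ k₂) (hexp : ¬ p ∣ ∑ k, a k ∨ ¬ p ∣ a k₁ + a k₂ + ∑ k, a k) {s₁ s₂ : X'.presheaf.stalk (σ x'')}
    (hs₁ : (τ.stalkMap (σ x'')).hom (c k₁) = e' * s₁) (hs₂ : (τ.stalkMap (σ x'')).hom (c k₂) = e' * s₂)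
    (hs₁m : s₁ ∈ maximalIdeal (X'.presheaf.stalk (σ x''))) (hs₂m : s₂ ∈ maximalIdeal (X'.presheaf.stalk (σ x'')))
    (hs₁N : s₁ ∉ Ideal.span ({e', y'} : Set (X'.presheaf.stalk (σ x''))))
    (hs₂N : s₂ ∉ Ideal.span ({e', y'} : Set (X'.presheaf.stalk (σ x''))))
    (hdim'' : ringKrullDim (X''.presheaf.stalk x'') = 3) {E ε ζ : X''.presheaf.stalk x''}
    (hE : Ideal.span {E} = (maximalIdeal (X'.presheaf.stalk (σ x''))).map (σ.stalkMap x'').hom)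
    (hε : (σ.stalkMap x'').hom e' = E * ε) (hεm : ε ∈ maximalIdeal (X''.presheaf.stalk x''))
    (hζ : (σ.stalkMap x'').hom y' = E * ζ) (hζm : ζ ∈ maximalIdeal (X''.presheaf.stalk x'')) :
    CleanPermissibleAt p (RatFn.toFunctionField x'') (RatFn.functionFieldMap σ (RatFn.functionFieldMap τ G))
      (Ideal.span ({ε, ζ} : Set (X''.presheaf.stalk x''))) := by
  obtain ⟨-, -, -, -, -, -, U, -, -, h⟩ := cleanPermissibleAt_nearLine_insertion_of_vertex_or_birth hτ hσ x'' hR c hc hdim hJ hcc hu a hrep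
    hdim' hJ' t hspan hdimd j₀ he' hy' hy'm hzz hk hs₁ hs₂ hs₁m hs₂m hs₁N hs₂N hdim'' hE hε hεm hζ hζm
  rcases h with h | ⟨h₁, h₂, -⟩
  · exact h
  · exact absurd h₂ (hexp.resolve_left (not_not.mpr h₁))

end Scheme

end Summit.ResolutionOfSingularities.ResolutionOfSingularities.Theorems.RadicialJung.CleanModels

end
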